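import Summits.FinalStateConjecture.FinalStateConjecture.Theorems.EIHFluxBalanceInertialRecessionStubSlavingHelpers
import Literature.Geometry.Lorentzian.CoordRicciScaling
import Literature.Geometry.Lorentzian.CoordBianchi

/-!
# Route EIHFluxBalance — `InertialRecession`, line `sublinear-is-free-clean-window-charges`:
# dilation covariance of the coordinate Ricci form and of its derivative (slaving stub `stub_slaving`)

Helper file for the crux `stmt-FinalStateConjecture-10166`
(`Summit.FinalStateConjecture.FinalStateConjecture.Theses.EIHFluxBalance.InertialRecession`),
stub `stub_slaving`, piece "R2" of the worker hand-off (the `C³` analogue of the relative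
Ricci-smallness capstone `exists_abs_ricAt_ansatz_le_jet`): the derivative `D Ric` of the frozen
ansatz must be bounded relative to its `3`-jet with a bound LINEAR in `‖D³g₀‖`, and the way to get
polynomial jet dependence out of the mere smoothness of the Ricci jet function
(`MetricCoord.contDiffOn_ricciJet`) is to ZOOM: under the dilation `ψ(z) = x + c (z − x)` the
components `G ∘ ψ` have jets `(G, c DG, c² D²G, c³ D³G)` at `x`, and

* `ricAt_comp_dilate` — **`Ric(G ∘ ψ)(z) = c² Ric(G)(ψ z)`** on `ψ⁻¹(V)` (naturality under the
  coordinate change `ψ`, `ricAt_pullMetric`, plus invariance of `Ric` under the constant rescaling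
  `pullMetric G ψ = c² (G ∘ ψ)`, `IsMetricOn.ricAt_const_smul_eq`);
* `fderiv_ricAt_comp_dilate` — **`D[Ric(G ∘ ψ)](x) = c³ D[Ric G](x)`** (chain rule at the fixed
  point `ψ x = x` of the dilation).

So with `c = (max(1, ‖DG‖, ‖D²G‖^{1/2}, ‖D³G‖^{1/3}))⁻¹` the rescaled jets lie in a fixed compact set
where `ricciJet` and its derivative are bounded and Lipschitz, and the factors `c⁻²`, `c⁻³` restore
exactly the degree structure. O'Neill 1983, Ch. 3, Prop. 3.59; Hamilton 1997, §C2 (scale invariance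
of `Ric`). Everything is generic (`E` finite-dimensional); no named facts.
-/

set_option linter.dupNamespace false
set_option maxSynthPendingDepth 3

noncomputable section

open Set Filter Function
open scoped Topology ContDiff
open Literature.Geometry.Lorentzian Literature.Geometry.Lorentzian.MetricCoord

namespace Summit.FinalStateConjecture.FinalStateConjecture.Theorems.SublinearIsFree.Slaving

section Dilate

variable {E : Type*} [NormedAddCommGroup E] [NormedSpace ℝ E] [FiniteDimensional ℝ E]
  [CompleteSpace E] {G : E → E →L[ℝ] E →L[ℝ] ℝ} {V : Set E} {x : E} {c : ℝ}

omit [FiniteDimensional ℝ E] [CompleteSpace E] in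
/-- The dilation `ψ(z) = x + c (z − x)` has derivative `c • id` everywhere. [folklore] -/
theorem hasFDerivAt_dilate (x : E) (c : ℝ) (z : E) :
    HasFDerivAt (fun w : E ↦ x + c • (w - x)) (c • ContinuousLinearMap.id ℝ E) z := by
  have h1 : HasFDerivAt (fun w : E ↦ w - x) (ContinuousLinearMap.id ℝ E) z :=
    (hasFDerivAt_id z).sub_const x
  have h2 := h1.const_smul c
  have h3 := h2.const_add x
  exact h3

omit [FiniteDimensional ℝ E] [CompleteSpace E] in
/-- `fderiv` of the dilation. [folklore] -/
theorem fderiv_dilate (x : E) (c : ℝ) (z : E) :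
    fderiv ℝ (fun w : E ↦ x + c • (w - x)) z = c • ContinuousLinearMap.id ℝ E :=
  (hasFDerivAt_dilate x c z).fderiv

omit [FiniteDimensional ℝ E] [CompleteSpace E] in
/-- The dilation is a change of coordinates from `ψ⁻¹(V)` onto `V` (`c ≠ 0`). [folklore] -/
theorem isCoordChangeOn_dilate (hV : IsOpen V) (hc : c ≠ 0) :
    IsCoordChangeOn (fun w : E ↦ x + c • (w - x)) ((fun w : E ↦ x + c • (w - x)) ⁻¹' V) V where
  isOpen := hV.preimage (by fun_prop)
  contDiffOn := ((contDiff_const.add (contDiff_const.smul (contDiff_id.sub contDiff_const)))).contDiffOn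
  mapsTo := fun _ hz ↦ hz
  isInvertible := fun z _ ↦ by
    rw [fderiv_dilate]
    refine ⟨ContinuousLinearEquiv.smulLeft (Units.mk0 c hc) , ?_⟩
    ext v
    simp

omit [FiniteDimensional ℝ E] [CompleteSpace E] in
/-- The dilated components `G ∘ ψ` are metric components on `ψ⁻¹(V)`. [folklore] -/
theorem isMetricOn_comp_dilate (hG : IsMetricOn G V) (c : ℝ) :
    IsMetricOn (fun w : E ↦ G (x + c • (w - x))) ((fun w : E ↦ x + c • (w - x)) ⁻¹' V) where
  isOpen := hG.isOpen.preimage (by fun_prop)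
  contDiffOn := hG.contDiffOn.comp
    ((contDiff_const.add (contDiff_const.smul (contDiff_id.sub contDiff_const)))).contDiffOn
    fun _ hz ↦ hz
  symm := fun z hz v w ↦ hG.symm _ hz v w
  isInvertible := fun z hz ↦ hG.isInvertible _ hz

omit [FiniteDimensional ℝ E] [CompleteSpace E] in
/-- `pullMetric G ψ = c² (G ∘ ψ)` for the dilation `ψ`. [folklore] -/
theorem pullMetric_dilate (x : E) (c : ℝ) :
    pullMetric G (fun w : E ↦ x + c • (w - x)) = fun w ↦ (c ^ 2) • G (x + c • (w - x)) := by
  funext w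
  ext v u
  rw [pullMetric_apply, fderiv_dilate]
  simp only [smul_apply, ContinuousLinearMap.id_apply, map_smul, smul_eq_mul]
  ring

/-- **Dilation covariance of the coordinate Ricci form**: `Ric(G ∘ ψ)(z) = c² Ric(G)(ψ z)` for the
dilation `ψ(w) = x + c (w − x)`, `c ≠ 0`, at every `z` with `ψ z ∈ V` (O'Neill 1983, Ch. 3,
Prop. 3.59 for the coordinate change `ψ`; scale invariance of `Ric` for the constant factor `c²`,
Hamilton 1997, §C2). [folklore] -/
theorem ricAt_comp_dilate (hG : IsMetricOn G V) (hc : c ≠ 0) {z : E}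
    (hz : x + c • (z - x) ∈ V) (Y Z : E) :
    ricAt (fun w : E ↦ G (x + c • (w - x))) z Y Z = c ^ 2 * ricAt G (x + c • (z - x)) Y Z := by
  have hz' : z ∈ (fun w : E ↦ x + c • (w - x)) ⁻¹' V := hz
  have hG' := isMetricOn_comp_dilate (x := x) hG c
  have hc2 : c ^ 2 ≠ 0 := pow_ne_zero 2 hc
  -- `Ric(c² (G ∘ ψ)) = Ric(G ∘ ψ)`
  have h1 := hG'.ricAt_const_smul hz' hc2 Y Z
  rw [← h1, ← pullMetric_dilate x c,
    ricAt_pullMetric hG (isCoordChangeOn_dilate hG.isOpen hc) hz' Y Z, fderiv_dilate]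
  simp only [smul_apply, ContinuousLinearMap.id_apply, map_smul, smul_eq_mul]
  ring

/-- **Dilation covariance of the derivative of the Ricci form**:
`D[Ric(G ∘ ψ)](x) = c³ D[Ric G](x)` at the fixed point `x` of the dilation (chain rule with
`ricAt_comp_dilate` on the open neighbourhood `ψ⁻¹(V)` of `x`; `Ric G` is smooth on `V`,
`IsMetricOn.contDiffAt_ricAt`). [folklore] -/
theorem fderiv_ricAt_comp_dilate (hG : IsMetricOn G V) (hx : x ∈ V) (hc : c ≠ 0) :
    fderiv ℝ (ricAt (fun w : E ↦ G (x + c • (w - x)))) x = (c ^ 3) • fderiv ℝ (ricAt G) x := by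
  set ψ : E → E := fun w ↦ x + c • (w - x) with hψ
  have hψx : ψ x = x := by simp [hψ]
  have hopen : IsOpen (ψ ⁻¹' V) := hG.isOpen.preimage (by fun_prop)
  have hxmem : x ∈ ψ ⁻¹' V := by show ψ x ∈ V; rw [hψx]; exact hx
  -- on `ψ⁻¹(V)`: `Ric(G ∘ ψ) = c² Ric(G) ∘ ψ`
  have heq : ricAt (fun w : E ↦ G (x + c • (w - x))) =ᶠ[𝓝 x]
      fun z ↦ (c ^ 2) • ricAt G (ψ z) := by
    filter_upwards [hopen.mem_nhds hxmem] with z hz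
    ext Y Z
    rw [ricAt_comp_dilate hG hc hz Y Z]
    rfl
  rw [heq.fderiv_eq]
  have hR : DifferentiableAt ℝ (ricAt G) (ψ x) := by
    rw [hψx]; exact hG.differentiableAt_ricAt hx
  have hψd : DifferentiableAt ℝ ψ x := (hasFDerivAt_dilate x c x).differentiableAt
  have hd : DifferentiableAt ℝ (fun z ↦ ricAt G (ψ z)) x := hR.comp x hψd
  have hcomp : fderiv ℝ (fun z ↦ ricAt G (ψ z)) x = (fderiv ℝ (ricAt G) x).comp (c • ContinuousLinearMap.id ℝ E) := by
    rw [fderiv_fun_comp x hR hψd, fderiv_dilate, hψx]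
  rw [fderiv_fun_const_smul hd, hcomp]
  ext v Y Z
  simp only [smul_apply, ContinuousLinearMap.comp_apply, ContinuousLinearMap.id_apply, map_smul]
  rw [smul_smul]
  ring_nf

end Dilate

/-- **Registered sub-goal form** (worker carrier `slaving_fderiv_ricAt_comp_dilate` of the crux item)
of `fderiv_ricAt_comp_dilate`, in the lab chart `E4`: `D[Ric(G ∘ ψ)](x) = c³ D[Ric G](x)` for the
dilation `ψ(w) = x + c (w − x)`. [folklore] -/
theorem slaving_fderiv_ricAt_comp_dilate : open Literature.Geometry.Lorentzian in ∀ {G : E4 → E4 →L[ℝ] E4 →L[ℝ] ℝ} {V : Set E4} {x : E4} {c : ℝ}, MetricCoord.IsMetricOn G V → x ∈ V → c ≠ 0 → fderiv ℝ (MetricCoord.ricAt (fun w : E4 ↦ G (x + c • (w - x)))) x = (c ^ 3) • fderiv ℝ (MetricCoord.ricAt G) x :=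
  fun hG hx hc ↦ fderiv_ricAt_comp_dilate hG hx hc

end Summit.FinalStateConjecture.FinalStateConjecture.Theorems.SublinearIsFree.Slaving

end
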